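import Literature.Analysis.FluidPDE.TorusHeatHolder
import Literature.Analysis.FunctionSpaces.ContDiffHolderLogConvex
import HarnessLib

/-!
# Commutators of the heat semigroup with a multiplier: kernel bounds and the torus recursion

Analysis/FluidPDE support file (all results proved; no definitions, no named facts). It serves
the discharge of the named fact `Literature.Analysis.FluidPDE.BDSV.commutatorCZBound`
(`FluidPDE/OnsagerBDSVPotentialTheory`; Buckmaster–De Lellis–Székelyhidi–Vicol 2019, App. D,
Prop. D.1, after Constantin 2015, Lemma 1: `‖[∂ᵢ∂ⱼΔ⁻¹, b·∇]f‖_α ≲ ‖b‖_{1+α}‖f‖_α`), carried out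
through the heat semigroup as for `BDSV.holderCZBound` (`FluidPDE/TorusHeatHolder`,
`FluidPDE/OnsagerBDSVPotentialTheoryProofs`): with `e^{σΔ} = heatExtension · σ` on `ℝ^d` and
the representation `(TF)~ = e^{Δ}(TF)~ - ∫₀¹ ∂ᵢ∂ⱼ e^{σΔ} F̃ dσ` of `T = ∂ᵢ∂ⱼΔ⁻¹`, the commutator
`[T, b·∇]f` is an integral in `σ` of *heat commutators with a multiplier*
`D^m e^{σΔ}(βg)~ - β̃ D^m e^{σΔ} g̃` (`m = 3`), plus lower-order terms.

This file provides the two kernel estimates on which everything rests and the recursion that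
reduces order `m` to order one:

* the **first-order heat commutator** `C_t(β,u)(x) = D(e^{tΔ}(βu))(x) - β(x) D(e^{tΔ}u)(x)
  = ∫ ∇G_t(y) ⊗ (β(x-y) - β(x)) u(x-y) dy` (`fderiv_heatExtension_smul_sub_eq_integral`) on a
  finite-dimensional inner product space, with the bounds
  `‖C_t(β,u)(x)‖ ≤ K₁ Lip(β) ‖u‖_∞` (`norm_fderiv_heatExtension_smul_sub_le`, order zero in `t`:
  `∫ ‖∇G_t(y)‖ ‖y‖ dy ≤ K₁ = 2√2·2^{n}`) and
  `‖C_t(β,u)(x) - C_t(β,u)(x')‖ ≤ K₁ (Lip(β)[u]_r + [∇β]_r ‖u‖_∞) ‖x - x'‖^r`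
  (`norm_fderiv_heatExtension_smul_sub_sub_le`; the second difference of `β` is
  `‖(β(x-y)-β(x)) - (β(x'-y)-β(x'))‖ ≤ [∇β]_r ‖x-x'‖^r ‖y‖`, `norm_sub_sub_sub_le_of_fderiv_holder'`);
* on the torus (`β, g` smooth on `T^d`, lifts `β̃, g̃`), the **step identity**
  `e^{(s+a)Δ}(∂ᵥψ_β)~ - β̃ e^{(s+a)Δ}(∂ᵥψ)~ = C_a(β̃, e^{sΔ}ψ̃) v + ∂ᵥ e^{aΔ}[e^{sΔ}ψ̃_β - β̃ e^{sΔ}ψ̃]`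
  (`heatExtension_lift_lineDeriv_sub_smul_eq_step`), and with it the sup bounds for the heat
  commutators of orders `1, 2, 3, 4` at times `a, 2a, 3a, 4a` for `g ∈ C^r`:
  `≲ 1, a^{(r-1)/2}, a^{r/2-1}, a^{(r-3)/2}` times `(m Lip(β̃)[g̃]_r + [∇β̃]_r ‖g‖_∞) ∏‖vᵢ‖`
  (`norm_heatComm₁_le`, …, `norm_heatComm₄_le`), the Hölder bound of the first-order one
  (`norm_heatComm₁_sub_le`) and the Lipschitz bound of the third-order one
  (`norm_heatComm₃_sub_le_rpow`, via `D C³ = C⁴ - (Dβ̃) D³e^{σΔ}g̃` and the mean value inequality),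
  in the currency `σ^{r/2-1}` / `σ^{(r-3)/2}` of the near-field calculus of `TorusHeatHolder`.

## References

* T. Buckmaster, C. De Lellis, L. Székelyhidi Jr., V. Vicol, *Onsager's conjecture for admissible
  weak solutions*, Comm. Pure Appl. Math. 72 (2019) 229–274 = arXiv:1701.08678, App. D,
  Prop. D.1. [`BuckmasterEtAl2018`]
* P. Constantin, *Lagrangian–Eulerian methods for uniqueness in hydrodynamic systems*, Adv. Math.
  278 (2015) 67–102, Lemma 1.
* A. Lunardi, *Analytic Semigroups and Optimal Regularity in Parabolic Problems* (1995), §3.1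
  (Hölder estimates via the heat semigroup).
-/

noncomputable section

open MeasureTheory Set Filter Topology InnerProductSpace
open Literature.Analysis.UnboundedOperators
open scoped Real ENNReal NNReal Laplacian ContDiff

namespace Literature.Analysis.FluidPDE

namespace TorusHeat

/-! ## The first-order heat commutator on a finite-dimensional inner product space -/

section Kernel

variable {E : Type*} [NormedAddCommGroup E] [InnerProductSpace ℝ E] [FiniteDimensional ℝ E]
  [MeasurableSpace E] [BorelSpace E]
variable {F : Type*} [NormedAddCommGroup F] [NormedSpace ℝ F]

/-- `y ↦ ‖∇G_t(y)‖ ‖y‖` is integrable (`‖∇G_t‖ ≤ 2^{n/2} t^{-1/2} G_{2t}` and the first moment of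
`G_{2t}`). [folklore] -/
theorem integrable_norm_fderiv_heatKernel_mul_norm {t : ℝ} (ht : 0 < t) :
    Integrable (fun y : E => ‖fderiv ℝ (heatKernel t) y‖ * ‖y‖) := by
  have h2t : 0 < 2 * t := by positivity
  set c : ℝ := (2 : ℝ) ^ ((Module.finrank ℝ E : ℝ) / 2) * t ^ (-(1 / 2 : ℝ)) with hc
  refine ((integrable_heatKernel_mul_norm (E := E) h2t).const_mul c).mono'
    ((continuous_fderiv_heatKernel t).norm.mul continuous_norm).aestronglyMeasurable
    (Eventually.of_forall fun y => ?_)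
  rw [Real.norm_of_nonneg (mul_nonneg (norm_nonneg _) (norm_nonneg _))]
  calc ‖fderiv ℝ (heatKernel t) y‖ * ‖y‖ ≤ (c * heatKernel (2 * t) y) * ‖y‖ :=
        mul_le_mul_of_nonneg_right (norm_fderiv_heatKernel_le_heatKernel_two_mul ht y) (norm_nonneg _)
    _ = c * (heatKernel (2 * t) y * ‖y‖) := by ring

/-- `t^{-1/2} (2t)^{1/2} = √2` for `0 < t`. [folklore] -/
theorem rpow_neg_half_mul_rpow_half {t : ℝ} (ht : 0 < t) :
    t ^ (-(1 / 2 : ℝ)) * (2 * t) ^ (1 / 2 : ℝ) = Real.sqrt 2 := by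
  rw [Real.mul_rpow (by norm_num : (0 : ℝ) ≤ 2) ht.le, Real.sqrt_eq_rpow,
    show t ^ (-(1 / 2 : ℝ)) * ((2 : ℝ) ^ (1 / 2 : ℝ) * t ^ (1 / 2 : ℝ)) =
      (2 : ℝ) ^ (1 / 2 : ℝ) * (t ^ (-(1 / 2 : ℝ)) * t ^ (1 / 2 : ℝ)) by ring,
    ← Real.rpow_add ht]
  norm_num

/-- **First moment of the gradient kernel, order zero in `t`**:
`∫ ‖∇G_t(y)‖ ‖y‖ dy ≤ 2√2 · (2^{n/2})²`. [folklore] -/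
theorem integral_norm_fderiv_heatKernel_mul_norm_le {t : ℝ} (ht : 0 < t) :
    ∫ y : E, ‖fderiv ℝ (heatKernel t) y‖ * ‖y‖ ≤
      2 * Real.sqrt 2 * ((2 : ℝ) ^ ((Module.finrank ℝ E : ℝ) / 2)) ^ 2 := by
  have h2t : 0 < 2 * t := by positivity
  set cn : ℝ := (2 : ℝ) ^ ((Module.finrank ℝ E : ℝ) / 2) with hcn
  set c : ℝ := cn * t ^ (-(1 / 2 : ℝ)) with hc
  have hc0 : 0 ≤ c := by positivity
  have hpt : ∀ y : E, ‖fderiv ℝ (heatKernel t) y‖ * ‖y‖ ≤ c * (heatKernel (2 * t) y * ‖y‖) := fun y =>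
    calc ‖fderiv ℝ (heatKernel t) y‖ * ‖y‖ ≤ (c * heatKernel (2 * t) y) * ‖y‖ :=
          mul_le_mul_of_nonneg_right (norm_fderiv_heatKernel_le_heatKernel_two_mul ht y) (norm_nonneg _)
      _ = c * (heatKernel (2 * t) y * ‖y‖) := by ring
  calc ∫ y : E, ‖fderiv ℝ (heatKernel t) y‖ * ‖y‖ ≤ ∫ y : E, c * (heatKernel (2 * t) y * ‖y‖) :=
        integral_mono (integrable_norm_fderiv_heatKernel_mul_norm ht)
          ((integrable_heatKernel_mul_norm h2t).const_mul c) hpt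
    _ = c * ∫ y : E, heatKernel (2 * t) y * ‖y‖ := integral_const_mul _ _
    _ ≤ c * (2 * cn * (2 * t) ^ (1 / 2 : ℝ)) :=
        mul_le_mul_of_nonneg_left (integral_heatKernel_mul_norm_le h2t) hc0
    _ = 2 * (t ^ (-(1 / 2 : ℝ)) * (2 * t) ^ (1 / 2 : ℝ)) * cn ^ 2 := by rw [hc]; ring
    _ = 2 * Real.sqrt 2 * cn ^ 2 := by rw [rpow_neg_half_mul_rpow_half ht]

/-- `y ↦ ∇G_t(y) ⊗ w(y)` is integrable for bounded continuous `w` (`0 < t`). [folklore] -/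
theorem integrable_fderiv_heatKernel_smulRight {w : E → F} (hw : Continuous w) {C : ℝ}
    (hC : ∀ y, ‖w y‖ ≤ C) {t : ℝ} (ht : 0 < t) :
    Integrable (fun y => (fderiv ℝ (heatKernel t) y).smulRight (w y)) := by
  refine ((integrable_norm_fderiv_heatKernel ht).mul_const C).mono'
    ((ContinuousLinearMap.smulRightL ℝ E F).continuous₂.comp_aestronglyMeasurable
      ((continuous_fderiv_heatKernel t).aestronglyMeasurable.prodMk hw.aestronglyMeasurable))
    (Eventually.of_forall fun y => ?_)
  rw [ContinuousLinearMap.norm_smulRight_apply]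
  exact mul_le_mul_of_nonneg_left (hC _) (norm_nonneg _)

/-- `y ↦ ∇G_t(y) ⊗ w(y)` is integrable when `‖w(y)‖ ≤ C ‖y‖` (`w` continuous, `0 < t`). [folklore] -/
theorem integrable_fderiv_heatKernel_smulRight_of_le_mul_norm {w : E → F} (hw : Continuous w)
    {C : ℝ} (hC : ∀ y, ‖w y‖ ≤ C * ‖y‖) {t : ℝ} (ht : 0 < t) :
    Integrable (fun y => (fderiv ℝ (heatKernel t) y).smulRight (w y)) := by
  refine (((integrable_norm_fderiv_heatKernel_mul_norm ht).const_mul C)).mono'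
    ((ContinuousLinearMap.smulRightL ℝ E F).continuous₂.comp_aestronglyMeasurable
      ((continuous_fderiv_heatKernel t).aestronglyMeasurable.prodMk hw.aestronglyMeasurable))
    (Eventually.of_forall fun y => ?_)
  rw [ContinuousLinearMap.norm_smulRight_apply]
  calc ‖fderiv ℝ (heatKernel t) y‖ * ‖w y‖ ≤ ‖fderiv ℝ (heatKernel t) y‖ * (C * ‖y‖) :=
        mul_le_mul_of_nonneg_left (hC _) (norm_nonneg _)
    _ = C * (‖fderiv ℝ (heatKernel t) y‖ * ‖y‖) := by ring

variable [CompleteSpace F]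

/-- **The first-order heat commutator as a kernel integral**: for bounded continuous `β : E → ℝ`,
`u : E → F` and `0 < t`,
`D(e^{tΔ}(βu))(x) - β(x) D(e^{tΔ}u)(x) = ∫ ∇G_t(y) ⊗ ((β(x-y) - β(x)) u(x-y)) dy`
(both sides through `fderiv_heatExtension_eq_integral_sub_self`; the terms at `x` cancel).
[folklore] -/
theorem fderiv_heatExtension_smul_sub_eq_integral {β : E → ℝ} {u : E → F} (hβ : Continuous β)
    (hu : Continuous u) {Cβ Cu : ℝ} (hCβ : ∀ z, ‖β z‖ ≤ Cβ) (hCu : ∀ z, ‖u z‖ ≤ Cu) {t : ℝ}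
    (ht : 0 < t) (x : E) :
    fderiv ℝ (heatExtension (fun z => β z • u z) t) x - β x • fderiv ℝ (heatExtension u t) x =
      ∫ y, (fderiv ℝ (heatKernel t) y).smulRight ((β (x - y) - β x) • u (x - y)) := by
  have hβu : Continuous fun z => β z • u z := hβ.smul hu
  have hCβ0 : 0 ≤ Cβ := (norm_nonneg _).trans (hCβ x)
  have hCu0 : 0 ≤ Cu := (norm_nonneg _).trans (hCu x)
  have hCβu : ∀ z, ‖β z • u z‖ ≤ Cβ * Cu := fun z => by
    rw [norm_smul]; exact mul_le_mul (hCβ z) (hCu z) (norm_nonneg _) hCβ0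
  rw [fderiv_heatExtension_eq_integral_sub_self hβu hCβu ht x,
    fderiv_heatExtension_eq_integral_sub_self hu hCu ht x]
  -- integrability of the three integrands
  have hI1 : Integrable (fun y => (fderiv ℝ (heatKernel t) y).smulRight (β (x - y) • u (x - y) - β x • u x)) :=
    integrable_fderiv_heatKernel_smulRight ((hβu.comp (continuous_const.sub continuous_id)).sub
      continuous_const) (C := Cβ * Cu + Cβ * Cu) (fun y => (norm_sub_le _ _).trans
        (add_le_add (hCβu _) (hCβu _))) ht
  have hI2 : Integrable (fun y => (fderiv ℝ (heatKernel t) y).smulRight (u (x - y) - u x)) :=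
    integrable_fderiv_heatKernel_smulRight ((hu.comp (continuous_const.sub continuous_id)).sub
      continuous_const) (C := Cu + Cu) (fun y => (norm_sub_le _ _).trans
        (add_le_add (hCu _) (hCu _))) ht
  have hI3 : Integrable (fun y => β x • (fderiv ℝ (heatKernel t) y).smulRight (u (x - y) - u x)) :=
    hI2.smul (β x)
  rw [← integral_smul, ← integral_sub hI1 hI3]
  refine integral_congr_ae (Eventually.of_forall fun y => ?_)
  ext v
  simp only [FunLike.coe_sub, Pi.sub_apply, ContinuousLinearMap.smulRight_apply,
    FunLike.coe_smul, Pi.smul_apply, smul_sub, sub_smul, smul_smul]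
  rw [mul_comm (β x) (fderiv ℝ (heatKernel t) y v)]
  abel

/-- **Size of the first-order heat commutator**: if moreover `‖β(y) - β(z)‖ ≤ L ‖y - z‖`
(`0 ≤ L`), then `‖D(e^{tΔ}(βu))(x) - β(x) D(e^{tΔ}u)(x)‖ ≤ 2√2 (2^{n/2})² L ‖u‖_∞` — order zero
in `t` (`∫ ‖∇G_t(y)‖ ‖y‖ dy ≲ 1`). [folklore] -/
theorem norm_fderiv_heatExtension_smul_sub_le {β : E → ℝ} {u : E → F} (hβ : Continuous β)
    (hu : Continuous u) {Cβ Cu L : ℝ} (hCβ : ∀ z, ‖β z‖ ≤ Cβ) (hCu : ∀ z, ‖u z‖ ≤ Cu)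
    (hL0 : 0 ≤ L) (hL : ∀ y z, ‖β y - β z‖ ≤ L * ‖y - z‖) {t : ℝ} (ht : 0 < t) (x : E) :
    ‖fderiv ℝ (heatExtension (fun z => β z • u z) t) x - β x • fderiv ℝ (heatExtension u t) x‖ ≤
      2 * Real.sqrt 2 * ((2 : ℝ) ^ ((Module.finrank ℝ E : ℝ) / 2)) ^ 2 * L * Cu := by
  have hCu0 : 0 ≤ Cu := (norm_nonneg _).trans (hCu x)
  rw [fderiv_heatExtension_smul_sub_eq_integral hβ hu hCβ hCu ht x]
  have hdom : Integrable (fun y : E => (L * Cu) * (‖fderiv ℝ (heatKernel t) y‖ * ‖y‖)) :=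
    (integrable_norm_fderiv_heatKernel_mul_norm ht).const_mul _
  calc ‖∫ y, (fderiv ℝ (heatKernel t) y).smulRight ((β (x - y) - β x) • u (x - y))‖
      ≤ ∫ y, (L * Cu) * (‖fderiv ℝ (heatKernel t) y‖ * ‖y‖) := by
        refine norm_integral_le_of_norm_le hdom (Eventually.of_forall fun y => ?_)
        rw [ContinuousLinearMap.norm_smulRight_apply, norm_smul]
        have h1 : ‖β (x - y) - β x‖ ≤ L * ‖y‖ := by
          have h := hL (x - y) x
          rwa [show x - y - x = -y by abel, norm_neg] at h
        calc ‖fderiv ℝ (heatKernel t) y‖ * (‖β (x - y) - β x‖ * ‖u (x - y)‖)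
            ≤ ‖fderiv ℝ (heatKernel t) y‖ * ((L * ‖y‖) * Cu) :=
              mul_le_mul_of_nonneg_left (mul_le_mul h1 (hCu _) (norm_nonneg _) (by positivity))
                (norm_nonneg _)
          _ = (L * Cu) * (‖fderiv ℝ (heatKernel t) y‖ * ‖y‖) := by ring
    _ = (L * Cu) * ∫ y, ‖fderiv ℝ (heatKernel t) y‖ * ‖y‖ := integral_const_mul _ _
    _ ≤ (L * Cu) * (2 * Real.sqrt 2 * ((2 : ℝ) ^ ((Module.finrank ℝ E : ℝ) / 2)) ^ 2) :=
        mul_le_mul_of_nonneg_left (integral_norm_fderiv_heatKernel_mul_norm_le ht) (by positivity)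
    _ = _ := by ring

/-- **Hölder increments of the first-order heat commutator**: if `‖β(y) - β(z)‖ ≤ L ‖y - z‖`,
the second differences of `β` satisfy `‖(β(x-y)-β(x)) - (β(x'-y)-β(x'))‖ ≤ H ‖x-x'‖^r ‖y‖`, and
`‖u‖ ≤ M`, `‖u(y) - u(z)‖ ≤ A ‖y - z‖^r`, then the commutator `C(x) = D(e^{tΔ}(βu))(x) - β(x) D(e^{tΔ}u)(x)`
satisfies `‖C(x) - C(x')‖ ≤ 2√2 (2^{n/2})² (L A + H M) ‖x - x'‖^r`. [folklore] -/
theorem norm_fderiv_heatExtension_smul_sub_sub_le {β : E → ℝ} {u : E → F} (hβ : Continuous β)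
    (hu : Continuous u) {Cβ M L H A r : ℝ} (hCβ : ∀ z, ‖β z‖ ≤ Cβ) (hM : ∀ z, ‖u z‖ ≤ M)
    (hL0 : 0 ≤ L) (hL : ∀ y z, ‖β y - β z‖ ≤ L * ‖y - z‖) (hH0 : 0 ≤ H)
    (hH : ∀ x x' y, ‖(β (x - y) - β x) - (β (x' - y) - β x')‖ ≤ H * ‖x - x'‖ ^ r * ‖y‖)
    (hA0 : 0 ≤ A) (hA : ∀ y z, ‖u y - u z‖ ≤ A * ‖y - z‖ ^ r) {t : ℝ} (ht : 0 < t) (x x' : E) :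
    ‖(fderiv ℝ (heatExtension (fun z => β z • u z) t) x - β x • fderiv ℝ (heatExtension u t) x) -
        (fderiv ℝ (heatExtension (fun z => β z • u z) t) x' - β x' • fderiv ℝ (heatExtension u t) x')‖ ≤
      2 * Real.sqrt 2 * ((2 : ℝ) ^ ((Module.finrank ℝ E : ℝ) / 2)) ^ 2 * (L * A + H * M) *
        ‖x - x'‖ ^ r := by
  have hM0 : 0 ≤ M := (norm_nonneg _).trans (hM x)
  rw [fderiv_heatExtension_smul_sub_eq_integral hβ hu hCβ hM ht x,
    fderiv_heatExtension_smul_sub_eq_integral hβ hu hCβ hM ht x']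
  -- integrability (the weights are `O(‖y‖)`)
  have hcont : ∀ x₀ : E, Continuous fun y => (β (x₀ - y) - β x₀) • u (x₀ - y) := fun x₀ =>
    ((hβ.comp (continuous_const.sub continuous_id)).sub continuous_const).smul
      (hu.comp (continuous_const.sub continuous_id))
  have hwt : ∀ x₀ y : E, ‖(β (x₀ - y) - β x₀) • u (x₀ - y)‖ ≤ (L * M) * ‖y‖ := fun x₀ y => by
    rw [norm_smul]
    have h := hL (x₀ - y) x₀
    rw [show x₀ - y - x₀ = -y by abel, norm_neg] at h
    calc ‖β (x₀ - y) - β x₀‖ * ‖u (x₀ - y)‖ ≤ (L * ‖y‖) * M :=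
          mul_le_mul h (hM _) (norm_nonneg _) (by positivity)
      _ = (L * M) * ‖y‖ := by ring
  have hI : ∀ x₀ : E, Integrable (fun y => (fderiv ℝ (heatKernel t) y).smulRight
      ((β (x₀ - y) - β x₀) • u (x₀ - y))) := fun x₀ =>
    integrable_fderiv_heatKernel_smulRight_of_le_mul_norm (hcont x₀) (hwt x₀) ht
  rw [← integral_sub (hI x) (hI x')]
  set ρ : ℝ := ‖x - x'‖ ^ r with hρ
  have hρ0 : 0 ≤ ρ := Real.rpow_nonneg (norm_nonneg _) _
  have hdom : Integrable (fun y : E => ((L * A + H * M) * ρ) * (‖fderiv ℝ (heatKernel t) y‖ * ‖y‖)) :=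
    (integrable_norm_fderiv_heatKernel_mul_norm ht).const_mul _
  calc ‖∫ y, ((fderiv ℝ (heatKernel t) y).smulRight ((β (x - y) - β x) • u (x - y)) -
          (fderiv ℝ (heatKernel t) y).smulRight ((β (x' - y) - β x') • u (x' - y)))‖
      ≤ ∫ y, ((L * A + H * M) * ρ) * (‖fderiv ℝ (heatKernel t) y‖ * ‖y‖) := by
        refine norm_integral_le_of_norm_le hdom (Eventually.of_forall fun y => ?_)
        have hsplit : (fderiv ℝ (heatKernel t) y).smulRight ((β (x - y) - β x) • u (x - y)) -
            (fderiv ℝ (heatKernel t) y).smulRight ((β (x' - y) - β x') • u (x' - y)) =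
            (fderiv ℝ (heatKernel t) y).smulRight
              ((β (x - y) - β x) • (u (x - y) - u (x' - y)) +
                ((β (x - y) - β x) - (β (x' - y) - β x')) • u (x' - y)) := by
          ext v
          simp only [FunLike.coe_sub, Pi.sub_apply, ContinuousLinearMap.smulRight_apply,
            smul_sub, sub_smul, smul_add]
          abel
        rw [hsplit, ContinuousLinearMap.norm_smulRight_apply]
        have h1 : ‖β (x - y) - β x‖ ≤ L * ‖y‖ := by
          have h := hL (x - y) x
          rwa [show x - y - x = -y by abel, norm_neg] at h
        have h2 : ‖u (x - y) - u (x' - y)‖ ≤ A * ρ := by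
          have h := hA (x - y) (x' - y)
          rwa [show x - y - (x' - y) = x - x' by abel] at h
        have h3 := hH x x' y
        have hin : ‖(β (x - y) - β x) • (u (x - y) - u (x' - y)) +
            ((β (x - y) - β x) - (β (x' - y) - β x')) • u (x' - y)‖ ≤
            (L * A + H * M) * ρ * ‖y‖ := by
          refine (norm_add_le _ _).trans ?_
          rw [norm_smul, norm_smul]
          calc ‖β (x - y) - β x‖ * ‖u (x - y) - u (x' - y)‖ +
                ‖β (x - y) - β x - (β (x' - y) - β x')‖ * ‖u (x' - y)‖
              ≤ (L * ‖y‖) * (A * ρ) + (H * ‖x - x'‖ ^ r * ‖y‖) * M :=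
                add_le_add (mul_le_mul h1 h2 (norm_nonneg _) (by positivity))
                  (mul_le_mul h3 (hM _) (norm_nonneg _) (by positivity))
            _ = (L * A + H * M) * ρ * ‖y‖ := by rw [hρ]; ring
        calc ‖fderiv ℝ (heatKernel t) y‖ * ‖(β (x - y) - β x) • (u (x - y) - u (x' - y)) +
              ((β (x - y) - β x) - (β (x' - y) - β x')) • u (x' - y)‖
            ≤ ‖fderiv ℝ (heatKernel t) y‖ * ((L * A + H * M) * ρ * ‖y‖) :=
              mul_le_mul_of_nonneg_left hin (norm_nonneg _)
          _ = ((L * A + H * M) * ρ) * (‖fderiv ℝ (heatKernel t) y‖ * ‖y‖) := by ring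
    _ = ((L * A + H * M) * ρ) * ∫ y, ‖fderiv ℝ (heatKernel t) y‖ * ‖y‖ := integral_const_mul _ _
    _ ≤ ((L * A + H * M) * ρ) * (2 * Real.sqrt 2 * ((2 : ℝ) ^ ((Module.finrank ℝ E : ℝ) / 2)) ^ 2) :=
        mul_le_mul_of_nonneg_left (integral_norm_fderiv_heatKernel_mul_norm_le ht) (by positivity)
    _ = _ := by rw [hρ]; ring

omit [InnerProductSpace ℝ E] [FiniteDimensional ℝ E] [MeasurableSpace E] [BorelSpace E]
  [CompleteSpace F] in
/-- **Second differences from a Hölder derivative**: if `φ` is differentiable with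
`‖Dφ(a) - Dφ(b)‖ ≤ H ‖a - b‖^r`, then `‖(φ(x-y) - φ(x)) - (φ(x'-y) - φ(x'))‖ ≤ H ‖x - x'‖^r ‖y‖`
(mean value inequality for `w ↦ φ(w) - φ(w + (x' - x))` on the segment `[x - y, x]`; cf.
`FunctionSpaces.norm_sub_sub_sub_le_of_fderiv_holder`, here with a real exponent). [folklore] -/
theorem norm_sub_sub_sub_le_of_fderiv_holder' {E' : Type*} [NormedAddCommGroup E'] [NormedSpace ℝ E']
    {φ : E' → F} (hφ : Differentiable ℝ φ) {r H : ℝ}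
    (hH : ∀ a b, ‖fderiv ℝ φ a - fderiv ℝ φ b‖ ≤ H * ‖a - b‖ ^ r) (x x' y : E') :
    ‖(φ (x - y) - φ x) - (φ (x' - y) - φ x')‖ ≤ H * ‖x - x'‖ ^ r * ‖y‖ := by
  set v : E' := x' - x with hv
  set Ψ : E' → F := fun w => φ w - φ (w + v) with hΨ
  have hΨd : ∀ w, DifferentiableAt ℝ Ψ w := fun w =>
    (hφ w).sub ((differentiableAt_comp_add_right v).2 (hφ (w + v)))
  have hDΨ : ∀ w, fderiv ℝ Ψ w = fderiv ℝ φ w - fderiv ℝ φ (w + v) := by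
    intro w
    have h1 : DifferentiableAt ℝ (fun w => φ (w + v)) w :=
      (differentiableAt_comp_add_right v).2 (hφ (w + v))
    rw [hΨ, fderiv_fun_sub (hφ w) h1, fderiv_comp_add_right]
  have hb : ∀ w ∈ (univ : Set E'), ‖fderiv ℝ Ψ w‖ ≤ H * ‖x - x'‖ ^ r := by
    intro w _
    rw [hDΨ]
    have := hH w (w + v)
    rwa [show w - (w + v) = -v by abel, norm_neg, hv, norm_sub_rev x' x] at this
  have h := Convex.norm_image_sub_le_of_norm_fderiv_le (fun w _ => hΨd w) hb convex_univ
    (mem_univ x) (mem_univ (x - y))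
  rw [show x - y - x = -y by abel, norm_neg] at h
  calc ‖(φ (x - y) - φ x) - (φ (x' - y) - φ x')‖ = ‖Ψ (x - y) - Ψ x‖ := by
        rw [hΨ]; dsimp only; rw [hv, show x - y + (x' - x) = x' - y by abel, show x + (x' - x) = x' by abel]
        congr 1; abel
    _ ≤ H * ‖x - x'‖ ^ r * ‖y‖ := h

end Kernel

/-! ## Heat commutators with a multiplier on the torus -/

section Torus

variable {d : Type*} [Fintype d]
variable {F : Type*} [NormedAddCommGroup F] [NormedSpace ℝ F] [CompleteSpace F]

omit [Fintype d] [NormedSpace ℝ F] [CompleteSpace F] in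
/-- The lift of a product is the product of the lifts. [folklore] -/
theorem lift_smul_eq {G : Type*} [SMul ℝ G] (β : UnitAddTorus d → ℝ) (g : UnitAddTorus d → G) :
    FunctionSpaces.Torus.lift (fun z => β z • g z) =
      fun y => FunctionSpaces.Torus.lift β y • FunctionSpaces.Torus.lift g y := rfl

omit [CompleteSpace F] in
/-- A derivative bound for the lift gives a Lipschitz bound (mean value inequality). [folklore] -/
theorem norm_lift_sub_lift_le_of_fderiv_le {β : UnitAddTorus d → F}
    (hβ : FunctionSpaces.Torus.IsSmooth β) {L : ℝ}
    (hL : ∀ y, ‖fderiv ℝ (FunctionSpaces.Torus.lift β) y‖ ≤ L) (y z : EuclideanSpace ℝ d) :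
    ‖FunctionSpaces.Torus.lift β y - FunctionSpaces.Torus.lift β z‖ ≤ L * ‖y - z‖ :=
  Convex.norm_image_sub_le_of_norm_fderiv_le
    (fun w _ => ((hβ.differentiable (by simp)) w)) (fun w _ => hL w) convex_univ (mem_univ z) (mem_univ y)

/-- **The first-order heat commutator of lifted data is the kernel commutator**:
`e^{aΔ}(∂ᵥ(βg))~(x) - β̃(x) e^{aΔ}(∂ᵥg)~(x) = D(e^{aΔ}(β̃g̃))(x)v - β̃(x) D(e^{aΔ}g̃)(x)v`
(derivatives fall on the data). [folklore] -/
theorem heatComm₁_eq {β : UnitAddTorus d → ℝ} {g : UnitAddTorus d → F}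
    (hβ : FunctionSpaces.Torus.IsSmooth β) (hg : FunctionSpaces.Torus.IsSmooth g) {a : ℝ} (ha : 0 < a)
    (x v : EuclideanSpace ℝ d) :
    heatExtension (FunctionSpaces.Torus.lift (fun z => FunctionSpaces.Torus.lineDeriv
        (fun w => β w • g w) z v)) a x -
      FunctionSpaces.Torus.lift β x • heatExtension (FunctionSpaces.Torus.lift
        (fun z => FunctionSpaces.Torus.lineDeriv g z v)) a x =
      (fderiv ℝ (heatExtension (fun y => FunctionSpaces.Torus.lift β y •
          FunctionSpaces.Torus.lift g y) a) x -
        FunctionSpaces.Torus.lift β x • fderiv ℝ (heatExtension (FunctionSpaces.Torus.lift g) a) x) v := by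
  rw [← fderiv_heatExtension_lift_apply (hβ.smul' hg) ha x v, ← fderiv_heatExtension_lift_apply hg ha x v]
  rfl

/-- **Size of the first-order heat commutator on the torus**: with `‖g‖ ≤ M` and `‖Dβ̃‖ ≤ L`,
`‖e^{aΔ}(∂ᵥ(βg))~(x) - β̃(x) e^{aΔ}(∂ᵥg)~(x)‖ ≤ 2√2 (2^{n/2})² L M ‖v‖`, uniformly in `a > 0`.
[folklore] -/
theorem norm_heatComm₁_le {β : UnitAddTorus d → ℝ} {g : UnitAddTorus d → F}
    (hβ : FunctionSpaces.Torus.IsSmooth β) (hg : FunctionSpaces.Torus.IsSmooth g) {M L : ℝ}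
    (hM : ∀ z, ‖g z‖ ≤ M) (hL : ∀ y, ‖fderiv ℝ (FunctionSpaces.Torus.lift β) y‖ ≤ L)
    {a : ℝ} (ha : 0 < a) (x v : EuclideanSpace ℝ d) :
    ‖heatExtension (FunctionSpaces.Torus.lift (fun z => FunctionSpaces.Torus.lineDeriv
        (fun w => β w • g w) z v)) a x -
      FunctionSpaces.Torus.lift β x • heatExtension (FunctionSpaces.Torus.lift
        (fun z => FunctionSpaces.Torus.lineDeriv g z v)) a x‖ ≤
      2 * Real.sqrt 2 * ((2 : ℝ) ^ ((Module.finrank ℝ (EuclideanSpace ℝ d) : ℝ) / 2)) ^ 2 * L * M * ‖v‖ := by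
  rw [heatComm₁_eq hβ hg ha x v]
  obtain ⟨Cβ, -, hCβ⟩ := exists_norm_lift_le hβ.continuous
  have hL0 : 0 ≤ L := (norm_nonneg _).trans (hL 0)
  refine (ContinuousLinearMap.le_opNorm _ _).trans (mul_le_mul_of_nonneg_right ?_ (norm_nonneg _))
  exact norm_fderiv_heatExtension_smul_sub_le (FunctionSpaces.Torus.continuous_lift_iff.2 hβ.continuous)
    (FunctionSpaces.Torus.continuous_lift_iff.2 hg.continuous) hCβ (fun z => hM _) hL0
    (norm_lift_sub_lift_le_of_fderiv_le hβ hL) ha x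

/-- **Hölder increments of the first-order heat commutator on the torus**: with `‖g‖ ≤ M`,
`‖g̃ y - g̃ z‖ ≤ A ‖y - z‖^r`, `‖Dβ̃‖ ≤ L` and `‖Dβ̃(a) - Dβ̃(b)‖ ≤ H ‖a - b‖^r`, the function
`x ↦ e^{aΔ}(∂ᵥ(βg))~(x) - β̃(x) e^{aΔ}(∂ᵥg)~(x)` has `r`-Hölder constant
`≤ 2√2 (2^{n/2})² (L A + H M) ‖v‖`, uniformly in `a > 0`. [folklore] -/
theorem norm_heatComm₁_sub_le {β : UnitAddTorus d → ℝ} {g : UnitAddTorus d → F}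
    (hβ : FunctionSpaces.Torus.IsSmooth β) (hg : FunctionSpaces.Torus.IsSmooth g) {M L H A r : ℝ}
    (hM : ∀ z, ‖g z‖ ≤ M) (hL : ∀ y, ‖fderiv ℝ (FunctionSpaces.Torus.lift β) y‖ ≤ L) (hH0 : 0 ≤ H)
    (hH : ∀ a b, ‖fderiv ℝ (FunctionSpaces.Torus.lift β) a - fderiv ℝ (FunctionSpaces.Torus.lift β) b‖ ≤
      H * ‖a - b‖ ^ r)
    (hA0 : 0 ≤ A) (hA : ∀ y z, ‖FunctionSpaces.Torus.lift g y - FunctionSpaces.Torus.lift g z‖ ≤ A * ‖y - z‖ ^ r)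
    {a : ℝ} (ha : 0 < a) (v x x' : EuclideanSpace ℝ d) :
    ‖(heatExtension (FunctionSpaces.Torus.lift (fun z => FunctionSpaces.Torus.lineDeriv
        (fun w => β w • g w) z v)) a x -
      FunctionSpaces.Torus.lift β x • heatExtension (FunctionSpaces.Torus.lift
        (fun z => FunctionSpaces.Torus.lineDeriv g z v)) a x) -
      (heatExtension (FunctionSpaces.Torus.lift (fun z => FunctionSpaces.Torus.lineDeriv
        (fun w => β w • g w) z v)) a x' -
      FunctionSpaces.Torus.lift β x' • heatExtension (FunctionSpaces.Torus.lift
        (fun z => FunctionSpaces.Torus.lineDeriv g z v)) a x')‖ ≤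
      2 * Real.sqrt 2 * ((2 : ℝ) ^ ((Module.finrank ℝ (EuclideanSpace ℝ d) : ℝ) / 2)) ^ 2 *
        (L * A + H * M) * ‖x - x'‖ ^ r * ‖v‖ := by
  rw [heatComm₁_eq hβ hg ha x v, heatComm₁_eq hβ hg ha x' v, ← sub_apply]
  obtain ⟨Cβ, -, hCβ⟩ := exists_norm_lift_le hβ.continuous
  have hL0 : 0 ≤ L := (norm_nonneg _).trans (hL 0)
  refine (ContinuousLinearMap.le_opNorm _ _).trans (mul_le_mul_of_nonneg_right ?_ (norm_nonneg _))
  have hH' := norm_sub_sub_sub_le_of_fderiv_holder' (hβ.differentiable (by simp)) hH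
  exact norm_fderiv_heatExtension_smul_sub_sub_le (FunctionSpaces.Torus.continuous_lift_iff.2 hβ.continuous)
    (FunctionSpaces.Torus.continuous_lift_iff.2 hg.continuous) hCβ (fun z => hM _) hL0
    (norm_lift_sub_lift_le_of_fderiv_le hβ hL) hH0 hH' hA0 hA ha x x'

/-- **The step identity.** For smooth `β, ψ_β, ψ` on `T^d` and `s, a > 0`, with
`C_s = e^{sΔ}ψ̃_β - β̃ e^{sΔ}ψ̃` (the commutator at time `s` when `ψ_β = D^m(βg)`, `ψ = D^m g`):
`e^{(s+a)Δ}(∂ᵥψ_β)~(x) - β̃(x) e^{(s+a)Δ}(∂ᵥψ)~(x)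
   = [D(e^{aΔ}(β̃ e^{sΔ}ψ̃))(x) - β̃(x) D(e^{aΔ}e^{sΔ}ψ̃)(x)] v + D(e^{aΔ} C_s)(x) v`
(`e^{(s+a)Δ} = e^{aΔ}e^{sΔ}`, derivatives fall on the data, and linearity of `e^{aΔ}` on the
decomposition `e^{sΔ}ψ̃_β = β̃ e^{sΔ}ψ̃ + C_s`). [folklore] -/
theorem heatExtension_lift_lineDeriv_sub_smul_eq_step {β : UnitAddTorus d → ℝ} {ψβ ψ : UnitAddTorus d → F}
    (hβ : FunctionSpaces.Torus.IsSmooth β) (hψβ : FunctionSpaces.Torus.IsSmooth ψβ)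
    (hψ : FunctionSpaces.Torus.IsSmooth ψ) {s a : ℝ} (hs : 0 < s) (ha : 0 < a)
    (x v : EuclideanSpace ℝ d) :
    heatExtension (FunctionSpaces.Torus.lift (fun z => FunctionSpaces.Torus.lineDeriv ψβ z v)) (s + a) x -
      FunctionSpaces.Torus.lift β x •
        heatExtension (FunctionSpaces.Torus.lift (fun z => FunctionSpaces.Torus.lineDeriv ψ z v)) (s + a) x =
      (fderiv ℝ (heatExtension (fun y => FunctionSpaces.Torus.lift β y •
            heatExtension (FunctionSpaces.Torus.lift ψ) s y) a) x v -
          FunctionSpaces.Torus.lift β x •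
            fderiv ℝ (heatExtension (heatExtension (FunctionSpaces.Torus.lift ψ) s) a) x v) +
        fderiv ℝ (heatExtension (fun y => heatExtension (FunctionSpaces.Torus.lift ψβ) s y -
          FunctionSpaces.Torus.lift β y • heatExtension (FunctionSpaces.Torus.lift ψ) s y) a) x v := by
  have hsa : 0 < s + a := by linarith
  rw [← fderiv_heatExtension_lift_apply hψβ hsa x v, ← heatExtension_heatExtension_lift hψβ.continuous hs ha,
    ← fderiv_heatExtension_lift_apply hψ hsa x v, ← heatExtension_heatExtension_lift hψ.continuous hs ha]
  -- the data at time `s`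
  set Uβ : EuclideanSpace ℝ d → F := heatExtension (FunctionSpaces.Torus.lift ψβ) s with hUβ
  set U : EuclideanSpace ℝ d → F := heatExtension (FunctionSpaces.Torus.lift ψ) s with hU
  set W : EuclideanSpace ℝ d → F := fun y => FunctionSpaces.Torus.lift β y • U y with hW
  set Cm : EuclideanSpace ℝ d → F := fun y => Uβ y - FunctionSpaces.Torus.lift β y • U y with hCm
  obtain ⟨Cβ, hCβ0, hCβ⟩ := exists_norm_lift_le hβ.continuous
  obtain ⟨Cψβ, -, hCψβ⟩ := exists_norm_le hψβ.continuous
  obtain ⟨Cψ, hCψ0, hCψ⟩ := exists_norm_le hψ.continuous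
  have hβc : Continuous (FunctionSpaces.Torus.lift β) := FunctionSpaces.Torus.continuous_lift_iff.2 hβ.continuous
  have hUβc : Continuous Uβ := (contDiff_heatExtension_lift hψβ.continuous hs (m := 0)).continuous
  have hUc : Continuous U := (contDiff_heatExtension_lift hψ.continuous hs (m := 0)).continuous
  have hUβb : ∀ y, ‖Uβ y‖ ≤ Cψβ := fun y => norm_heatExtension_lift_le hCψβ hs y
  have hUb : ∀ y, ‖U y‖ ≤ Cψ := fun y => norm_heatExtension_lift_le hCψ hs y
  have hWc : Continuous W := hβc.smul hUc
  have hWb : ∀ y, ‖W y‖ ≤ Cβ * Cψ := fun y => by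
    rw [hW]; dsimp only; rw [norm_smul]
    exact mul_le_mul (hCβ y) (hUb y) (norm_nonneg _) hCβ0
  have hCmc : Continuous Cm := hUβc.sub (hβc.smul hUc)
  have hCmb : ∀ y, ‖Cm y‖ ≤ Cψβ + Cβ * Cψ := fun y =>
    (norm_sub_le _ _).trans (add_le_add (hUβb y) (hWb y))
  -- the decomposition and linearity
  have hdec : Uβ = fun y => W y + Cm y := funext fun y => by simp [hW, hCm]
  have hsum : heatExtension Uβ a = fun y => heatExtension W a y + heatExtension Cm a y := by
    funext y
    rw [hdec]
    exact heatExtension_add_of_bound hWc hCmc hWb hCmb ha y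
  have hdW : DifferentiableAt ℝ (heatExtension W a) x :=
    ((contDiff_heatExtension_of_bound hWc hWb ha (m := 1)).differentiable one_ne_zero) x
  have hdC : DifferentiableAt ℝ (heatExtension Cm a) x :=
    ((contDiff_heatExtension_of_bound hCmc hCmb ha (m := 1)).differentiable one_ne_zero) x
  rw [hsum, fderiv_fun_add hdW hdC]
  simp only [add_apply]
  abel

/-- **The step bound (sup form).** In the setting of the step identity, if `‖e^{sΔ}ψ̃‖ ≤ M_U`,
`‖Dβ̃‖ ≤ L` and the commutator at time `s` satisfies `‖C_s‖ ≤ M_C`, then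
`‖e^{(s+a)Δ}(∂ᵥψ_β)~(x) - β̃(x) e^{(s+a)Δ}(∂ᵥψ)~(x)‖ ≤ (2√2 (2^{n/2})² L M_U + 2^{n/2} a^{-1/2} M_C) ‖v‖`.
[folklore] -/
theorem norm_heatExtension_lift_lineDeriv_sub_smul_le_step {β : UnitAddTorus d → ℝ}
    {ψβ ψ : UnitAddTorus d → F} (hβ : FunctionSpaces.Torus.IsSmooth β)
    (hψβ : FunctionSpaces.Torus.IsSmooth ψβ) (hψ : FunctionSpaces.Torus.IsSmooth ψ) {s a : ℝ}
    (hs : 0 < s) (ha : 0 < a) {L MU MC : ℝ} (hL : ∀ y, ‖fderiv ℝ (FunctionSpaces.Torus.lift β) y‖ ≤ L)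
    (hMU : ∀ y, ‖heatExtension (FunctionSpaces.Torus.lift ψ) s y‖ ≤ MU)
    (hMC : ∀ y, ‖heatExtension (FunctionSpaces.Torus.lift ψβ) s y -
      FunctionSpaces.Torus.lift β y • heatExtension (FunctionSpaces.Torus.lift ψ) s y‖ ≤ MC)
    (x v : EuclideanSpace ℝ d) :
    ‖heatExtension (FunctionSpaces.Torus.lift (fun z => FunctionSpaces.Torus.lineDeriv ψβ z v)) (s + a) x -
      FunctionSpaces.Torus.lift β x •
        heatExtension (FunctionSpaces.Torus.lift (fun z => FunctionSpaces.Torus.lineDeriv ψ z v)) (s + a) x‖ ≤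
      (2 * Real.sqrt 2 * ((2 : ℝ) ^ ((Module.finrank ℝ (EuclideanSpace ℝ d) : ℝ) / 2)) ^ 2 * L * MU +
        (2 : ℝ) ^ ((Module.finrank ℝ (EuclideanSpace ℝ d) : ℝ) / 2) * a ^ (-(1 / 2 : ℝ)) * MC) * ‖v‖ := by
  rw [heatExtension_lift_lineDeriv_sub_smul_eq_step hβ hψβ hψ hs ha x v]
  obtain ⟨Cβ, hCβ0, hCβ⟩ := exists_norm_lift_le hβ.continuous
  obtain ⟨Cψβ, -, hCψβ⟩ := exists_norm_le hψβ.continuous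
  have hβc : Continuous (FunctionSpaces.Torus.lift β) := FunctionSpaces.Torus.continuous_lift_iff.2 hβ.continuous
  have hUβc : Continuous (heatExtension (FunctionSpaces.Torus.lift ψβ) s) :=
    (contDiff_heatExtension_lift hψβ.continuous hs (m := 0)).continuous
  have hUc : Continuous (heatExtension (FunctionSpaces.Torus.lift ψ) s) :=
    (contDiff_heatExtension_lift hψ.continuous hs (m := 0)).continuous
  have hL0 : 0 ≤ L := (norm_nonneg _).trans (hL 0)
  have hCmc : Continuous (fun y => heatExtension (FunctionSpaces.Torus.lift ψβ) s y -
      FunctionSpaces.Torus.lift β y • heatExtension (FunctionSpaces.Torus.lift ψ) s y) :=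
    hUβc.sub (hβc.smul hUc)
  refine (norm_add_le _ _).trans ?_
  rw [add_mul]
  refine add_le_add ?_ ?_
  · exact (ContinuousLinearMap.le_opNorm _ _).trans (mul_le_mul_of_nonneg_right
      (norm_fderiv_heatExtension_smul_sub_le hβc hUc hCβ hMU hL0
        (norm_lift_sub_lift_le_of_fderiv_le hβ hL) ha x) (norm_nonneg v))
  · exact norm_fderiv_heatExtension_apply_le_of_bounded hCmc.aestronglyMeasurable hMC ha x v

/-- **The step bound (Hölder form).** As in the sup form, but using an `r`-Hölder bound
`‖C_s(y) - C_s(z)‖ ≤ A_C ‖y - z‖^r` (`0 ≤ r ≤ 1`) of the commutator at time `s` and the Hölder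
gradient gain: the second term becomes `2^{n/2} a^{-1/2} (1+2·2^{n/2}) (2a)^{r/2} A_C`. [folklore] -/
theorem norm_heatExtension_lift_lineDeriv_sub_smul_le_step_holder {β : UnitAddTorus d → ℝ}
    {ψβ ψ : UnitAddTorus d → F} (hβ : FunctionSpaces.Torus.IsSmooth β)
    (hψβ : FunctionSpaces.Torus.IsSmooth ψβ) (hψ : FunctionSpaces.Torus.IsSmooth ψ) {s a : ℝ}
    (hs : 0 < s) (ha : 0 < a) {L MU MC AC r : ℝ} (hL : ∀ y, ‖fderiv ℝ (FunctionSpaces.Torus.lift β) y‖ ≤ L)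
    (hMU : ∀ y, ‖heatExtension (FunctionSpaces.Torus.lift ψ) s y‖ ≤ MU)
    (hMC : ∀ y, ‖heatExtension (FunctionSpaces.Torus.lift ψβ) s y -
      FunctionSpaces.Torus.lift β y • heatExtension (FunctionSpaces.Torus.lift ψ) s y‖ ≤ MC)
    (hAC0 : 0 ≤ AC) (hr0 : 0 ≤ r) (hr1 : r ≤ 1)
    (hAC : ∀ y z, ‖(heatExtension (FunctionSpaces.Torus.lift ψβ) s y -
      FunctionSpaces.Torus.lift β y • heatExtension (FunctionSpaces.Torus.lift ψ) s y) -
      (heatExtension (FunctionSpaces.Torus.lift ψβ) s z -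
      FunctionSpaces.Torus.lift β z • heatExtension (FunctionSpaces.Torus.lift ψ) s z)‖ ≤ AC * ‖y - z‖ ^ r)
    (x v : EuclideanSpace ℝ d) :
    ‖heatExtension (FunctionSpaces.Torus.lift (fun z => FunctionSpaces.Torus.lineDeriv ψβ z v)) (s + a) x -
      FunctionSpaces.Torus.lift β x •
        heatExtension (FunctionSpaces.Torus.lift (fun z => FunctionSpaces.Torus.lineDeriv ψ z v)) (s + a) x‖ ≤
      (2 * Real.sqrt 2 * ((2 : ℝ) ^ ((Module.finrank ℝ (EuclideanSpace ℝ d) : ℝ) / 2)) ^ 2 * L * MU +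
        (2 : ℝ) ^ ((Module.finrank ℝ (EuclideanSpace ℝ d) : ℝ) / 2) * a ^ (-(1 / 2 : ℝ)) *
          ((1 + 2 * (2 : ℝ) ^ ((Module.finrank ℝ (EuclideanSpace ℝ d) : ℝ) / 2)) * (2 * a) ^ (r / 2)) * AC) *
        ‖v‖ := by
  rw [heatExtension_lift_lineDeriv_sub_smul_eq_step hβ hψβ hψ hs ha x v]
  obtain ⟨Cβ, hCβ0, hCβ⟩ := exists_norm_lift_le hβ.continuous
  have hβc : Continuous (FunctionSpaces.Torus.lift β) := FunctionSpaces.Torus.continuous_lift_iff.2 hβ.continuous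
  have hUβc : Continuous (heatExtension (FunctionSpaces.Torus.lift ψβ) s) :=
    (contDiff_heatExtension_lift hψβ.continuous hs (m := 0)).continuous
  have hUc : Continuous (heatExtension (FunctionSpaces.Torus.lift ψ) s) :=
    (contDiff_heatExtension_lift hψ.continuous hs (m := 0)).continuous
  have hL0 : 0 ≤ L := (norm_nonneg _).trans (hL 0)
  have hCmc : Continuous (fun y => heatExtension (FunctionSpaces.Torus.lift ψβ) s y -
      FunctionSpaces.Torus.lift β y • heatExtension (FunctionSpaces.Torus.lift ψ) s y) :=
    hUβc.sub (hβc.smul hUc)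
  refine (norm_add_le _ _).trans ?_
  rw [add_mul]
  refine add_le_add ?_ ?_
  · exact (ContinuousLinearMap.le_opNorm _ _).trans (mul_le_mul_of_nonneg_right
      (norm_fderiv_heatExtension_smul_sub_le hβc hUc hCβ hMU hL0
        (norm_lift_sub_lift_le_of_fderiv_le hβ hL) ha x) (norm_nonneg v))
  · exact norm_fderiv_heatExtension_apply_le_of_holder hCmc hMC hAC0 hr0 hr1 hAC ha x v

/-- **Order two** (time `2a`, directions `v₂ v₃`): with `‖g‖ ≤ M`, `‖g̃ y - g̃ z‖ ≤ A ‖y - z‖^r`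
(`0 ≤ r ≤ 1`), `‖Dβ̃‖ ≤ L`, `‖Dβ̃(a) - Dβ̃(b)‖ ≤ H ‖a - b‖^r`,
`‖e^{2aΔ}(∂₂∂₃(βg))~(x) - β̃(x) e^{2aΔ}(∂₂∂₃g)~(x)‖
  ≤ 2^{n/2} a^{-1/2} (1+2·2^{n/2}) (2a)^{r/2} · 2√2 (2^{n/2})² (2 L A + H M) ‖v₂‖ ‖v₃‖`, i.e.
`≲ a^{(r-1)/2}` (step identity at `s = a`; the inner commutator is fed through the Hölder gradient
gain with `norm_heatComm₁_sub_le`). [folklore] -/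
theorem norm_heatComm₂_le {β : UnitAddTorus d → ℝ} {g : UnitAddTorus d → F}
    (hβ : FunctionSpaces.Torus.IsSmooth β) (hg : FunctionSpaces.Torus.IsSmooth g) {M L H A r : ℝ}
    (hM : ∀ z, ‖g z‖ ≤ M) (hL : ∀ y, ‖fderiv ℝ (FunctionSpaces.Torus.lift β) y‖ ≤ L) (hH0 : 0 ≤ H)
    (hH : ∀ a b, ‖fderiv ℝ (FunctionSpaces.Torus.lift β) a - fderiv ℝ (FunctionSpaces.Torus.lift β) b‖ ≤
      H * ‖a - b‖ ^ r)
    (hA0 : 0 ≤ A) (hr0 : 0 ≤ r) (hr1 : r ≤ 1)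
    (hA : ∀ y z, ‖FunctionSpaces.Torus.lift g y - FunctionSpaces.Torus.lift g z‖ ≤ A * ‖y - z‖ ^ r)
    {a : ℝ} (ha : 0 < a) (x v₂ v₃ : EuclideanSpace ℝ d) :
    ‖heatExtension (FunctionSpaces.Torus.lift (fun z => FunctionSpaces.Torus.lineDeriv
        (fun z' => FunctionSpaces.Torus.lineDeriv (fun w => β w • g w) z' v₃) z v₂)) (a + a) x -
      FunctionSpaces.Torus.lift β x • heatExtension (FunctionSpaces.Torus.lift
        (fun z => FunctionSpaces.Torus.lineDeriv (fun z' => FunctionSpaces.Torus.lineDeriv g z' v₃) z v₂))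
          (a + a) x‖ ≤
      (2 : ℝ) ^ ((Module.finrank ℝ (EuclideanSpace ℝ d) : ℝ) / 2) * a ^ (-(1 / 2 : ℝ)) *
        ((1 + 2 * (2 : ℝ) ^ ((Module.finrank ℝ (EuclideanSpace ℝ d) : ℝ) / 2)) * (2 * a) ^ (r / 2)) *
        (2 * Real.sqrt 2 * ((2 : ℝ) ^ ((Module.finrank ℝ (EuclideanSpace ℝ d) : ℝ) / 2)) ^ 2 *
          (2 * L * A + H * M)) * ‖v₂‖ * ‖v₃‖ := by
  set c : ℝ := (2 : ℝ) ^ ((Module.finrank ℝ (EuclideanSpace ℝ d) : ℝ) / 2) with hc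
  set cH : ℝ := 1 + 2 * c with hcH
  set K₁ : ℝ := 2 * Real.sqrt 2 * c ^ 2 with hK₁
  have hL0 : 0 ≤ L := (norm_nonneg _).trans (hL 0)
  have hM0 : 0 ≤ M := (norm_nonneg _).trans (hM 0)
  have hβg : FunctionSpaces.Torus.IsSmooth (fun w => β w • g w) := hβ.smul' hg
  have h := norm_heatExtension_lift_lineDeriv_sub_smul_le_step_holder hβ (hβg.lineDeriv v₃) (hg.lineDeriv v₃)
    ha ha hL (MU := c * a ^ (-(1 / 2 : ℝ)) * (cH * (2 * a) ^ (r / 2)) * A * ‖v₃‖)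
    (MC := K₁ * L * M * ‖v₃‖) (AC := K₁ * (L * A + H * M) * ‖v₃‖) (r := r)
    (fun y => norm_heatExtension_lift_lineDeriv_le_of_holder hg hA0 hr0 hr1 hA ha y v₃)
    (fun y => norm_heatComm₁_le hβ hg hM hL ha y v₃) (by positivity) hr0 hr1
    (fun y z => (norm_heatComm₁_sub_le hβ hg hM hL hH0 hH hA0 hA ha v₃ y z).trans_eq (by ring)) x v₂
  refine h.trans_eq ?_
  rw [hK₁]; ring

/-- **Order three** (time `3a`, directions `v₁ v₂ v₃`), same hypotheses:
`‖e^{3aΔ}(∂₁∂₂∂₃(βg))~(x) - β̃(x) e^{3aΔ}(∂₁∂₂∂₃g)~(x)‖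
  ≤ (2^{n/2} a^{-1/2})² (1+2·2^{n/2}) (2a)^{r/2} · 2√2 (2^{n/2})² (3 L A + H M) ‖v₁‖ ‖v₂‖ ‖v₃‖`, i.e.
`≲ a^{r/2-1}` (step identity at `s = 2a` with `norm_heatComm₂_le`). [folklore] -/
theorem norm_heatComm₃_le {β : UnitAddTorus d → ℝ} {g : UnitAddTorus d → F}
    (hβ : FunctionSpaces.Torus.IsSmooth β) (hg : FunctionSpaces.Torus.IsSmooth g) {M L H A r : ℝ}
    (hM : ∀ z, ‖g z‖ ≤ M) (hL : ∀ y, ‖fderiv ℝ (FunctionSpaces.Torus.lift β) y‖ ≤ L) (hH0 : 0 ≤ H)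
    (hH : ∀ a b, ‖fderiv ℝ (FunctionSpaces.Torus.lift β) a - fderiv ℝ (FunctionSpaces.Torus.lift β) b‖ ≤
      H * ‖a - b‖ ^ r)
    (hA0 : 0 ≤ A) (hr0 : 0 ≤ r) (hr1 : r ≤ 1)
    (hA : ∀ y z, ‖FunctionSpaces.Torus.lift g y - FunctionSpaces.Torus.lift g z‖ ≤ A * ‖y - z‖ ^ r)
    {a : ℝ} (ha : 0 < a) (x v₁ v₂ v₃ : EuclideanSpace ℝ d) :
    ‖heatExtension (FunctionSpaces.Torus.lift (fun z => FunctionSpaces.Torus.lineDeriv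
        (fun z' => FunctionSpaces.Torus.lineDeriv (fun z'' => FunctionSpaces.Torus.lineDeriv
          (fun w => β w • g w) z'' v₃) z' v₂) z v₁)) (a + a + a) x -
      FunctionSpaces.Torus.lift β x • heatExtension (FunctionSpaces.Torus.lift
        (fun z => FunctionSpaces.Torus.lineDeriv (fun z' => FunctionSpaces.Torus.lineDeriv
          (fun z'' => FunctionSpaces.Torus.lineDeriv g z'' v₃) z' v₂) z v₁)) (a + a + a) x‖ ≤
      ((2 : ℝ) ^ ((Module.finrank ℝ (EuclideanSpace ℝ d) : ℝ) / 2) * a ^ (-(1 / 2 : ℝ))) ^ 2 *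
        ((1 + 2 * (2 : ℝ) ^ ((Module.finrank ℝ (EuclideanSpace ℝ d) : ℝ) / 2)) * (2 * a) ^ (r / 2)) *
        (2 * Real.sqrt 2 * ((2 : ℝ) ^ ((Module.finrank ℝ (EuclideanSpace ℝ d) : ℝ) / 2)) ^ 2 *
          (3 * L * A + H * M)) * ‖v₁‖ * ‖v₂‖ * ‖v₃‖ := by
  set c : ℝ := (2 : ℝ) ^ ((Module.finrank ℝ (EuclideanSpace ℝ d) : ℝ) / 2) with hc
  set cH : ℝ := 1 + 2 * c with hcH
  set K₁ : ℝ := 2 * Real.sqrt 2 * c ^ 2 with hK₁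
  have hβg : FunctionSpaces.Torus.IsSmooth (fun w => β w • g w) := hβ.smul' hg
  have haa : 0 < a + a := by linarith
  have h := norm_heatExtension_lift_lineDeriv_sub_smul_le_step hβ ((hβg.lineDeriv v₃).lineDeriv v₂)
    ((hg.lineDeriv v₃).lineDeriv v₂) haa ha hL
    (MU := c * a ^ (-(1 / 2 : ℝ)) * (c * a ^ (-(1 / 2 : ℝ)) * (cH * (2 * a) ^ (r / 2)) * A * ‖v₃‖) * ‖v₂‖)
    (MC := c * a ^ (-(1 / 2 : ℝ)) * (cH * (2 * a) ^ (r / 2)) * (K₁ * (2 * L * A + H * M)) * ‖v₂‖ * ‖v₃‖)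
    (fun y => norm_heatExtension_lift_lineDeriv₂_le_of_holder hg hA0 hr0 hr1 hA ha y v₂ v₃)
    (fun y => norm_heatComm₂_le hβ hg hM hL hH0 hH hA0 hr0 hr1 hA ha y v₂ v₃) x v₁
  refine h.trans_eq ?_
  rw [hK₁]; ring

/-- **Order four** (time `4a`, directions `v₀ v₁ v₂ v₃`), same hypotheses:
`‖e^{4aΔ}(∂₀∂₁∂₂∂₃(βg))~(x) - β̃(x) e^{4aΔ}(∂₀∂₁∂₂∂₃g)~(x)‖
  ≤ (2^{n/2} a^{-1/2})³ (1+2·2^{n/2}) (2a)^{r/2} · 2√2 (2^{n/2})² (4 L A + H M) ∏ ‖vᵢ‖`, i.e.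
`≲ a^{(r-3)/2}` (step identity at `s = 3a` with `norm_heatComm₃_le`). [folklore] -/
theorem norm_heatComm₄_le {β : UnitAddTorus d → ℝ} {g : UnitAddTorus d → F}
    (hβ : FunctionSpaces.Torus.IsSmooth β) (hg : FunctionSpaces.Torus.IsSmooth g) {M L H A r : ℝ}
    (hM : ∀ z, ‖g z‖ ≤ M) (hL : ∀ y, ‖fderiv ℝ (FunctionSpaces.Torus.lift β) y‖ ≤ L) (hH0 : 0 ≤ H)
    (hH : ∀ a b, ‖fderiv ℝ (FunctionSpaces.Torus.lift β) a - fderiv ℝ (FunctionSpaces.Torus.lift β) b‖ ≤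
      H * ‖a - b‖ ^ r)
    (hA0 : 0 ≤ A) (hr0 : 0 ≤ r) (hr1 : r ≤ 1)
    (hA : ∀ y z, ‖FunctionSpaces.Torus.lift g y - FunctionSpaces.Torus.lift g z‖ ≤ A * ‖y - z‖ ^ r)
    {a : ℝ} (ha : 0 < a) (x v₀ v₁ v₂ v₃ : EuclideanSpace ℝ d) :
    ‖heatExtension (FunctionSpaces.Torus.lift (fun z₀ => FunctionSpaces.Torus.lineDeriv
        (fun z => FunctionSpaces.Torus.lineDeriv
        (fun z' => FunctionSpaces.Torus.lineDeriv (fun z'' => FunctionSpaces.Torus.lineDeriv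
          (fun w => β w • g w) z'' v₃) z' v₂) z v₁) z₀ v₀)) (a + a + a + a) x -
      FunctionSpaces.Torus.lift β x • heatExtension (FunctionSpaces.Torus.lift
        (fun z₀ => FunctionSpaces.Torus.lineDeriv
        (fun z => FunctionSpaces.Torus.lineDeriv (fun z' => FunctionSpaces.Torus.lineDeriv
          (fun z'' => FunctionSpaces.Torus.lineDeriv g z'' v₃) z' v₂) z v₁) z₀ v₀)) (a + a + a + a) x‖ ≤
      ((2 : ℝ) ^ ((Module.finrank ℝ (EuclideanSpace ℝ d) : ℝ) / 2) * a ^ (-(1 / 2 : ℝ))) ^ 3 *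
        ((1 + 2 * (2 : ℝ) ^ ((Module.finrank ℝ (EuclideanSpace ℝ d) : ℝ) / 2)) * (2 * a) ^ (r / 2)) *
        (2 * Real.sqrt 2 * ((2 : ℝ) ^ ((Module.finrank ℝ (EuclideanSpace ℝ d) : ℝ) / 2)) ^ 2 *
          (4 * L * A + H * M)) * ‖v₀‖ * ‖v₁‖ * ‖v₂‖ * ‖v₃‖ := by
  set c : ℝ := (2 : ℝ) ^ ((Module.finrank ℝ (EuclideanSpace ℝ d) : ℝ) / 2) with hc
  set cH : ℝ := 1 + 2 * c with hcH
  set K₁ : ℝ := 2 * Real.sqrt 2 * c ^ 2 with hK₁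
  have hβg : FunctionSpaces.Torus.IsSmooth (fun w => β w • g w) := hβ.smul' hg
  have haaa : 0 < a + a + a := by linarith
  have h := norm_heatExtension_lift_lineDeriv_sub_smul_le_step hβ
    (((hβg.lineDeriv v₃).lineDeriv v₂).lineDeriv v₁) (((hg.lineDeriv v₃).lineDeriv v₂).lineDeriv v₁) haaa ha hL
    (MU := c * a ^ (-(1 / 2 : ℝ)) * (c * a ^ (-(1 / 2 : ℝ)) *
      (c * a ^ (-(1 / 2 : ℝ)) * (cH * (2 * a) ^ (r / 2)) * A * ‖v₃‖) * ‖v₂‖) * ‖v₁‖)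
    (MC := (c * a ^ (-(1 / 2 : ℝ))) ^ 2 * (cH * (2 * a) ^ (r / 2)) * (K₁ * (3 * L * A + H * M)) *
      ‖v₁‖ * ‖v₂‖ * ‖v₃‖)
    (fun y => norm_heatExtension_lift_lineDeriv₃_le_of_holder hg hA0 hr0 hr1 hA ha y v₁ v₂ v₃)
    (fun y => norm_heatComm₃_le hβ hg hM hL hH0 hH hA0 hr0 hr1 hA ha y v₁ v₂ v₃) x v₀
  refine h.trans_eq ?_
  rw [hK₁]; ring

/-- **The third-order commutator is Lipschitz** (time `σ`, directions `v₁ v₂ v₃`), same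
hypotheses: with `G(x) = e^{σΔ}(∂₁∂₂∂₃(βg))~(x) - β̃(x) e^{σΔ}(∂₁∂₂∂₃g)~(x)`,
`‖G(x) - G(y)‖ ≤ Λ(σ) ‖x - y‖`, where `Λ(σ)` is the sum of the fourth-order bound
`norm_heatComm₄_le` at `a = σ/4` (over unit `v₀`) and `L` times the third-order smoothing bound
at `a = σ/3` (`DG = C⁴ - (Dβ̃) e^{σΔ}(∂³g)~` and the mean value inequality). [folklore] -/
theorem norm_heatComm₃_sub_le {β : UnitAddTorus d → ℝ} {g : UnitAddTorus d → F}
    (hβ : FunctionSpaces.Torus.IsSmooth β) (hg : FunctionSpaces.Torus.IsSmooth g) {M L H A r : ℝ}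
    (hM : ∀ z, ‖g z‖ ≤ M) (hL : ∀ y, ‖fderiv ℝ (FunctionSpaces.Torus.lift β) y‖ ≤ L) (hH0 : 0 ≤ H)
    (hH : ∀ a b, ‖fderiv ℝ (FunctionSpaces.Torus.lift β) a - fderiv ℝ (FunctionSpaces.Torus.lift β) b‖ ≤
      H * ‖a - b‖ ^ r)
    (hA0 : 0 ≤ A) (hr0 : 0 ≤ r) (hr1 : r ≤ 1)
    (hA : ∀ y z, ‖FunctionSpaces.Torus.lift g y - FunctionSpaces.Torus.lift g z‖ ≤ A * ‖y - z‖ ^ r)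
    {σ : ℝ} (hσ : 0 < σ) (v₁ v₂ v₃ x y : EuclideanSpace ℝ d) :
    ‖(heatExtension (FunctionSpaces.Torus.lift (fun z => FunctionSpaces.Torus.lineDeriv
        (fun z' => FunctionSpaces.Torus.lineDeriv (fun z'' => FunctionSpaces.Torus.lineDeriv
          (fun w => β w • g w) z'' v₃) z' v₂) z v₁)) σ x -
      FunctionSpaces.Torus.lift β x • heatExtension (FunctionSpaces.Torus.lift
        (fun z => FunctionSpaces.Torus.lineDeriv (fun z' => FunctionSpaces.Torus.lineDeriv
          (fun z'' => FunctionSpaces.Torus.lineDeriv g z'' v₃) z' v₂) z v₁)) σ x) -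
      (heatExtension (FunctionSpaces.Torus.lift (fun z => FunctionSpaces.Torus.lineDeriv
        (fun z' => FunctionSpaces.Torus.lineDeriv (fun z'' => FunctionSpaces.Torus.lineDeriv
          (fun w => β w • g w) z'' v₃) z' v₂) z v₁)) σ y -
      FunctionSpaces.Torus.lift β y • heatExtension (FunctionSpaces.Torus.lift
        (fun z => FunctionSpaces.Torus.lineDeriv (fun z' => FunctionSpaces.Torus.lineDeriv
          (fun z'' => FunctionSpaces.Torus.lineDeriv g z'' v₃) z' v₂) z v₁)) σ y)‖ ≤
      (((2 : ℝ) ^ ((Module.finrank ℝ (EuclideanSpace ℝ d) : ℝ) / 2) * (σ / 4) ^ (-(1 / 2 : ℝ))) ^ 3 *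
          ((1 + 2 * (2 : ℝ) ^ ((Module.finrank ℝ (EuclideanSpace ℝ d) : ℝ) / 2)) * (2 * (σ / 4)) ^ (r / 2)) *
          (2 * Real.sqrt 2 * ((2 : ℝ) ^ ((Module.finrank ℝ (EuclideanSpace ℝ d) : ℝ) / 2)) ^ 2 *
            (4 * L * A + H * M)) +
        L * (((2 : ℝ) ^ ((Module.finrank ℝ (EuclideanSpace ℝ d) : ℝ) / 2) * (σ / 3) ^ (-(1 / 2 : ℝ))) ^ 3 *
          ((1 + 2 * (2 : ℝ) ^ ((Module.finrank ℝ (EuclideanSpace ℝ d) : ℝ) / 2)) * (2 * (σ / 3)) ^ (r / 2)) * A)) *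
        ‖v₁‖ * ‖v₂‖ * ‖v₃‖ * ‖x - y‖ := by
  set c : ℝ := (2 : ℝ) ^ ((Module.finrank ℝ (EuclideanSpace ℝ d) : ℝ) / 2) with hc
  set cH : ℝ := 1 + 2 * c with hcH
  set K₁ : ℝ := 2 * Real.sqrt 2 * c ^ 2 with hK₁
  have hc0 : 0 < c := Real.rpow_pos_of_pos two_pos _
  have hL0 : 0 ≤ L := (norm_nonneg _).trans (hL 0)
  have hM0 : 0 ≤ M := (norm_nonneg _).trans (hM 0)
  have hβg : FunctionSpaces.Torus.IsSmooth (fun w => β w • g w) := hβ.smul' hg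
  set ψβ : UnitAddTorus d → F := fun z => FunctionSpaces.Torus.lineDeriv
    (fun z' => FunctionSpaces.Torus.lineDeriv (fun z'' => FunctionSpaces.Torus.lineDeriv
      (fun w => β w • g w) z'' v₃) z' v₂) z v₁ with hψβ_def
  set ψ : UnitAddTorus d → F := fun z => FunctionSpaces.Torus.lineDeriv
    (fun z' => FunctionSpaces.Torus.lineDeriv (fun z'' => FunctionSpaces.Torus.lineDeriv g z'' v₃) z' v₂) z v₁
    with hψ_def
  have hψβ : FunctionSpaces.Torus.IsSmooth ψβ := ((hβg.lineDeriv v₃).lineDeriv v₂).lineDeriv v₁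
  have hψ : FunctionSpaces.Torus.IsSmooth ψ := ((hg.lineDeriv v₃).lineDeriv v₂).lineDeriv v₁
  set Pβ : EuclideanSpace ℝ d → F := heatExtension (FunctionSpaces.Torus.lift ψβ) σ with hPβ
  set P : EuclideanSpace ℝ d → F := heatExtension (FunctionSpaces.Torus.lift ψ) σ with hP
  set B : EuclideanSpace ℝ d → ℝ := FunctionSpaces.Torus.lift β with hB
  set G : EuclideanSpace ℝ d → F := fun z => Pβ z - B z • P z with hG
  have hPβd : Differentiable ℝ Pβ := (contDiff_heatExtension_lift hψβ.continuous hσ (m := 1)).differentiable one_ne_zero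
  have hPd : Differentiable ℝ P := (contDiff_heatExtension_lift hψ.continuous hσ (m := 1)).differentiable one_ne_zero
  have hBd : Differentiable ℝ B := hβ.differentiable (by simp)
  have hGd : ∀ z, DifferentiableAt ℝ G z := fun z => (hPβd z).sub ((hBd z).smul (hPd z))
  -- the two constants
  set B₄ : ℝ := (c * (σ / 4) ^ (-(1 / 2 : ℝ))) ^ 3 * (cH * (2 * (σ / 4)) ^ (r / 2)) *
    (K₁ * (4 * L * A + H * M)) with hB₄
  set B₃ : ℝ := (c * (σ / 3) ^ (-(1 / 2 : ℝ))) ^ 3 * (cH * (2 * (σ / 3)) ^ (r / 2)) * A with hB₃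
  have hσ4 : 0 < σ / 4 := by positivity
  have hσ3 : 0 < σ / 3 := by positivity
  have hB₄0 : 0 ≤ B₄ := by positivity
  have hB₃0 : 0 ≤ B₃ := by positivity
  set n123 : ℝ := ‖v₁‖ * ‖v₂‖ * ‖v₃‖ with hn123
  have hn0 : 0 ≤ n123 := by positivity
  -- the derivative of `G`
  have hDG : ∀ z v₀, fderiv ℝ G z v₀ =
      (heatExtension (FunctionSpaces.Torus.lift (fun z₀ => FunctionSpaces.Torus.lineDeriv ψβ z₀ v₀)) σ z -
        B z • heatExtension (FunctionSpaces.Torus.lift (fun z₀ => FunctionSpaces.Torus.lineDeriv ψ z₀ v₀)) σ z) -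
      (fderiv ℝ B z v₀) • P z := by
    intro z v₀
    have hGder : HasFDerivAt G (fderiv ℝ Pβ z - (B z • fderiv ℝ P z + (fderiv ℝ B z).smulRight (P z))) z :=
      (hPβd z).hasFDerivAt.sub ((hBd z).hasFDerivAt.smul (hPd z).hasFDerivAt)
    rw [hGder.fderiv]
    simp only [sub_apply, add_apply, ContinuousLinearMap.smulRight_apply, FunLike.coe_smul, Pi.smul_apply]
    rw [hPβ, hP, fderiv_heatExtension_lift_apply hψβ hσ z v₀, fderiv_heatExtension_lift_apply hψ hσ z v₀]
    abel
  have hbound : ∀ z, ‖fderiv ℝ G z‖ ≤ (B₄ + L * B₃) * n123 := by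
    intro z
    refine ContinuousLinearMap.opNorm_le_bound _ (by positivity) fun v₀ => ?_
    rw [hDG z v₀]
    have h4 := norm_heatComm₄_le hβ hg hM hL hH0 hH hA0 hr0 hr1 hA hσ4 z v₀ v₁ v₂ v₃
    rw [show σ / 4 + σ / 4 + σ / 4 + σ / 4 = σ by ring, ← hc, ← hcH, ← hK₁] at h4
    have h3 := norm_heatExtension_lift_lineDeriv₃_le_of_holder hg hA0 hr0 hr1 hA hσ3 z v₁ v₂ v₃
    rw [show σ / 3 + σ / 3 + σ / 3 = σ by ring, ← hc, ← hcH] at h3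
    have hDB : ‖fderiv ℝ B z v₀‖ ≤ L * ‖v₀‖ := (ContinuousLinearMap.le_opNorm _ _).trans
      (mul_le_mul_of_nonneg_right (hL z) (norm_nonneg _))
    calc ‖(heatExtension (FunctionSpaces.Torus.lift (fun z₀ => FunctionSpaces.Torus.lineDeriv ψβ z₀ v₀)) σ z -
          B z • heatExtension (FunctionSpaces.Torus.lift (fun z₀ => FunctionSpaces.Torus.lineDeriv ψ z₀ v₀)) σ z) -
          (fderiv ℝ B z v₀) • P z‖
        ≤ ‖heatExtension (FunctionSpaces.Torus.lift (fun z₀ => FunctionSpaces.Torus.lineDeriv ψβ z₀ v₀)) σ z -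
          B z • heatExtension (FunctionSpaces.Torus.lift (fun z₀ => FunctionSpaces.Torus.lineDeriv ψ z₀ v₀)) σ z‖ +
          ‖(fderiv ℝ B z v₀) • P z‖ := norm_sub_le _ _
      _ ≤ B₄ * ‖v₀‖ * ‖v₁‖ * ‖v₂‖ * ‖v₃‖ + (L * ‖v₀‖) * (B₃ * ‖v₁‖ * ‖v₂‖ * ‖v₃‖) := by
          refine add_le_add (h4.trans_eq (by rw [hB₄])) ?_
          rw [norm_smul]
          refine mul_le_mul hDB (h3.trans_eq ?_) (norm_nonneg _) (by positivity)
          rw [hB₃]; ring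
      _ = (B₄ + L * B₃) * n123 * ‖v₀‖ := by rw [hn123]; ring
  have := Convex.norm_image_sub_le_of_norm_fderiv_le (fun z _ => hGd z) (fun z _ => hbound z)
    convex_univ (mem_univ y) (mem_univ x)
  rw [hG] at this
  refine this.trans_eq ?_
  rw [hB₄, hB₃, hn123]; ring

/-- `((σ/3)^{-1/2})² (2(σ/3))^{r/2} = 3 (2^{r/2}/3^{r/2}) σ^{r/2-1}` for `0 < σ`. [folklore] -/
theorem rpow_div_three_aux₂ {σ : ℝ} (hσ : 0 < σ) (r : ℝ) :
    ((σ / 3) ^ (-(1 / 2 : ℝ))) ^ 2 * (2 * (σ / 3)) ^ (r / 2) =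
      3 * ((2 : ℝ) ^ (r / 2) / (3 : ℝ) ^ (r / 2)) * σ ^ (r / 2 - 1) := by
  have h3 : (0 : ℝ) ≤ 3 := by norm_num
  have hσ3 : 0 < σ / 3 := by positivity
  rw [← Real.rpow_natCast, ← Real.rpow_mul hσ3.le, Real.mul_rpow (by norm_num) hσ3.le,
    Real.div_rpow hσ.le h3, Real.div_rpow hσ.le h3,
    show (-(1 / 2 : ℝ)) * ((2 : ℕ) : ℝ) = -1 by norm_num, Real.rpow_neg hσ.le, Real.rpow_neg h3,
    Real.rpow_one, Real.rpow_one, show r / 2 - 1 = r / 2 + (-1) by ring, Real.rpow_add hσ,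
    Real.rpow_neg hσ.le, Real.rpow_one]
  field_simp

/-- `((σ/4)^{-1/2})³ (2(σ/4))^{r/2} = 8 (2^{r/2}/4^{r/2}) σ^{(r-3)/2}` for `0 < σ`. [folklore] -/
theorem rpow_div_four_aux₃ {σ : ℝ} (hσ : 0 < σ) (r : ℝ) :
    ((σ / 4) ^ (-(1 / 2 : ℝ))) ^ 3 * (2 * (σ / 4)) ^ (r / 2) =
      8 * ((2 : ℝ) ^ (r / 2) / (4 : ℝ) ^ (r / 2)) * σ ^ ((r - 3) / 2) := by
  have h4 : (0 : ℝ) ≤ 4 := by norm_num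
  have hσ4 : 0 < σ / 4 := by positivity
  have h8 : (4 : ℝ) ^ ((3 : ℝ) / 2) = 8 := by
    rw [show (4 : ℝ) = 2 ^ (2 : ℝ) by norm_num, ← Real.rpow_mul (by norm_num)]
    norm_num
  rw [← Real.rpow_natCast, ← Real.rpow_mul hσ4.le, Real.mul_rpow (by norm_num) hσ4.le,
    Real.div_rpow hσ.le h4, Real.div_rpow hσ.le h4,
    show (-(1 / 2 : ℝ)) * ((3 : ℕ) : ℝ) = -(3 / 2 : ℝ) by norm_num, Real.rpow_neg hσ.le, Real.rpow_neg h4,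
    h8, show (r - 3) / 2 = r / 2 + (-(3 / 2 : ℝ)) by ring, Real.rpow_add hσ, Real.rpow_neg hσ.le]
  field_simp

/-- **Third-order commutator, near-field size**: for `0 < σ`,
`‖e^{σΔ}(∂₁∂₂∂₃(βg))~(x) - β̃(x) e^{σΔ}(∂₁∂₂∂₃g)~(x)‖ ≤ K (3 L A + H M) ‖v₁‖ ‖v₂‖ ‖v₃‖ σ^{r/2-1}`
with `K = 3 (2^{r/2}/3^{r/2}) (2^{n/2})² (1+2·2^{n/2}) · 2√2 (2^{n/2})²`. [folklore] -/
theorem norm_heatComm₃_le_rpow {β : UnitAddTorus d → ℝ} {g : UnitAddTorus d → F}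
    (hβ : FunctionSpaces.Torus.IsSmooth β) (hg : FunctionSpaces.Torus.IsSmooth g) {M L H A r : ℝ}
    (hM : ∀ z, ‖g z‖ ≤ M) (hL : ∀ y, ‖fderiv ℝ (FunctionSpaces.Torus.lift β) y‖ ≤ L) (hH0 : 0 ≤ H)
    (hH : ∀ a b, ‖fderiv ℝ (FunctionSpaces.Torus.lift β) a - fderiv ℝ (FunctionSpaces.Torus.lift β) b‖ ≤
      H * ‖a - b‖ ^ r)
    (hA0 : 0 ≤ A) (hr0 : 0 ≤ r) (hr1 : r ≤ 1)
    (hA : ∀ y z, ‖FunctionSpaces.Torus.lift g y - FunctionSpaces.Torus.lift g z‖ ≤ A * ‖y - z‖ ^ r)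
    {σ : ℝ} (hσ : 0 < σ) (x v₁ v₂ v₃ : EuclideanSpace ℝ d) :
    ‖heatExtension (FunctionSpaces.Torus.lift (fun z => FunctionSpaces.Torus.lineDeriv
        (fun z' => FunctionSpaces.Torus.lineDeriv (fun z'' => FunctionSpaces.Torus.lineDeriv
          (fun w => β w • g w) z'' v₃) z' v₂) z v₁)) σ x -
      FunctionSpaces.Torus.lift β x • heatExtension (FunctionSpaces.Torus.lift
        (fun z => FunctionSpaces.Torus.lineDeriv (fun z' => FunctionSpaces.Torus.lineDeriv
          (fun z'' => FunctionSpaces.Torus.lineDeriv g z'' v₃) z' v₂) z v₁)) σ x‖ ≤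
      (3 * ((2 : ℝ) ^ (r / 2) / (3 : ℝ) ^ (r / 2)) * ((2 : ℝ) ^ ((Module.finrank ℝ (EuclideanSpace ℝ d) : ℝ) / 2)) ^ 2 *
        (1 + 2 * (2 : ℝ) ^ ((Module.finrank ℝ (EuclideanSpace ℝ d) : ℝ) / 2)) *
        (2 * Real.sqrt 2 * ((2 : ℝ) ^ ((Module.finrank ℝ (EuclideanSpace ℝ d) : ℝ) / 2)) ^ 2)) *
        (3 * L * A + H * M) * ‖v₁‖ * ‖v₂‖ * ‖v₃‖ * σ ^ (r / 2 - 1) := by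
  have hσ3 : 0 < σ / 3 := by positivity
  have h := norm_heatComm₃_le hβ hg hM hL hH0 hH hA0 hr0 hr1 hA hσ3 x v₁ v₂ v₃
  rw [show σ / 3 + σ / 3 + σ / 3 = σ by ring] at h
  refine h.trans_eq ?_
  rw [show ∀ c q cH p K S n₁ n₂ n₃ : ℝ, (c * q) ^ 2 * (cH * p) * (K * S) * n₁ * n₂ * n₃ =
      (q ^ 2 * p) * c ^ 2 * cH * K * S * n₁ * n₂ * n₃ from fun c q cH p K S n₁ n₂ n₃ => by ring,
    rpow_div_three_aux₂ hσ r]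
  ring

/-- **Third-order commutator, near-field Lipschitz bound**: for `0 < σ`, the function
`x ↦ e^{σΔ}(∂₁∂₂∂₃(βg))~(x) - β̃(x) e^{σΔ}(∂₁∂₂∂₃g)~(x)` is Lipschitz with constant
`(K₄ (4 L A + H M) + K₃ L A) ‖v₁‖ ‖v₂‖ ‖v₃‖ σ^{(r-3)/2}`, `K₄ = 8 (2^{r/2}/4^{r/2}) (2^{n/2})³ (1+2·2^{n/2}) 2√2 (2^{n/2})²`,
`K₃ = (2^{r/2}/3^{r/2} · 3^{3/2}) (2^{n/2})³ (1+2·2^{n/2})`. [folklore] -/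
theorem norm_heatComm₃_sub_le_rpow {β : UnitAddTorus d → ℝ} {g : UnitAddTorus d → F}
    (hβ : FunctionSpaces.Torus.IsSmooth β) (hg : FunctionSpaces.Torus.IsSmooth g) {M L H A r : ℝ}
    (hM : ∀ z, ‖g z‖ ≤ M) (hL : ∀ y, ‖fderiv ℝ (FunctionSpaces.Torus.lift β) y‖ ≤ L) (hH0 : 0 ≤ H)
    (hH : ∀ a b, ‖fderiv ℝ (FunctionSpaces.Torus.lift β) a - fderiv ℝ (FunctionSpaces.Torus.lift β) b‖ ≤
      H * ‖a - b‖ ^ r)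
    (hA0 : 0 ≤ A) (hr0 : 0 ≤ r) (hr1 : r ≤ 1)
    (hA : ∀ y z, ‖FunctionSpaces.Torus.lift g y - FunctionSpaces.Torus.lift g z‖ ≤ A * ‖y - z‖ ^ r)
    {σ : ℝ} (hσ : 0 < σ) (v₁ v₂ v₃ x y : EuclideanSpace ℝ d) :
    ‖(heatExtension (FunctionSpaces.Torus.lift (fun z => FunctionSpaces.Torus.lineDeriv
        (fun z' => FunctionSpaces.Torus.lineDeriv (fun z'' => FunctionSpaces.Torus.lineDeriv
          (fun w => β w • g w) z'' v₃) z' v₂) z v₁)) σ x -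
      FunctionSpaces.Torus.lift β x • heatExtension (FunctionSpaces.Torus.lift
        (fun z => FunctionSpaces.Torus.lineDeriv (fun z' => FunctionSpaces.Torus.lineDeriv
          (fun z'' => FunctionSpaces.Torus.lineDeriv g z'' v₃) z' v₂) z v₁)) σ x) -
      (heatExtension (FunctionSpaces.Torus.lift (fun z => FunctionSpaces.Torus.lineDeriv
        (fun z' => FunctionSpaces.Torus.lineDeriv (fun z'' => FunctionSpaces.Torus.lineDeriv
          (fun w => β w • g w) z'' v₃) z' v₂) z v₁)) σ y -
      FunctionSpaces.Torus.lift β y • heatExtension (FunctionSpaces.Torus.lift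
        (fun z => FunctionSpaces.Torus.lineDeriv (fun z' => FunctionSpaces.Torus.lineDeriv
          (fun z'' => FunctionSpaces.Torus.lineDeriv g z'' v₃) z' v₂) z v₁)) σ y)‖ ≤
      ((8 * ((2 : ℝ) ^ (r / 2) / (4 : ℝ) ^ (r / 2)) * ((2 : ℝ) ^ ((Module.finrank ℝ (EuclideanSpace ℝ d) : ℝ) / 2)) ^ 3 *
          (1 + 2 * (2 : ℝ) ^ ((Module.finrank ℝ (EuclideanSpace ℝ d) : ℝ) / 2)) *
          (2 * Real.sqrt 2 * ((2 : ℝ) ^ ((Module.finrank ℝ (EuclideanSpace ℝ d) : ℝ) / 2)) ^ 2)) *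
          (4 * L * A + H * M) +
        (((2 : ℝ) ^ (r / 2) / (3 : ℝ) ^ (r / 2) * (3 : ℝ) ^ ((3 : ℝ) / 2)) *
          ((2 : ℝ) ^ ((Module.finrank ℝ (EuclideanSpace ℝ d) : ℝ) / 2)) ^ 3 *
          (1 + 2 * (2 : ℝ) ^ ((Module.finrank ℝ (EuclideanSpace ℝ d) : ℝ) / 2))) * L * A) *
        ‖v₁‖ * ‖v₂‖ * ‖v₃‖ * σ ^ ((r - 3) / 2) * ‖x - y‖ := by
  have h := norm_heatComm₃_sub_le hβ hg hM hL hH0 hH hA0 hr0 hr1 hA hσ v₁ v₂ v₃ x y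
  refine h.trans_eq ?_
  rw [show ∀ c q₄ cH p₄ K S L' q₃ p₃ A' n₁ n₂ n₃ D : ℝ,
      ((c * q₄) ^ 3 * (cH * p₄) * (K * S) + L' * ((c * q₃) ^ 3 * (cH * p₃) * A')) * n₁ * n₂ * n₃ * D =
      ((q₄ ^ 3 * p₄) * c ^ 3 * cH * K * S + (p₃ * q₃ ^ 3) * c ^ 3 * cH * L' * A') * n₁ * n₂ * n₃ * D
      from fun c q₄ cH p₄ K S L' q₃ p₃ A' n₁ n₂ n₃ D => by ring,
    rpow_div_four_aux₃ hσ r, rpow_div_three_aux' hσ r]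
  ring

end Torus

end TorusHeat

end Literature.Analysis.FluidPDE
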